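import Summits.Ventures.PercRepro.S1CoreCapChain

/-!
# PercRepro — S2: THE 4-CIRCUIT CAP `s₄ ≤ 46` ON A COLOOP-FREE CORE OF NULLITY `7` ON `24` POINTS — THE SERIES-CLASS
AVERAGING (p7, gen 8; sub-claim S2, the cell `(17, 7)`)

The averaging step (p1 / p2: `s₄(M) ≤ #4circ(x) + s₄(M ＼ x)`, some non-coloop `x` on `≤ ⌊4·s₄/m⌋` quads) loses the
coloops of the deletion: `M ＼ x` is a core of nullity one less, but its non-coloop count — which drives the bound
`s₄(M ＼ x) ≤ ⌊m′·B/(m′ − 4)⌋` — is `|E| − 1 − k_x`, where `k_x = #coloops(M ＼ x)` = the number of SERIES PARTNERS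
of `x` (a coloop `f` of `M ＼ x` that is not a coloop of `M` lies in every circuit through `x`:
`mem_of_isColoop_delete_of_mem_isCircuit`). Two cases on a coloop-free core `M` of nullity `7` on `24` points, with
`s₄ ≤ B₅ = 28` on every core of nullity `5` (the hypothesis `hB5`; p8's `avgChain16 5`):
* some point `e` has `k_e ≥ 3` series partners: every quad through `e` contains the `k_e + 1` points `{e} ∪ K`, so
  there is at most one such quad (`k_e = 3`) or none (`k_e ≥ 4`), and `M ＼ e` has `m = 23 − k_e ∈ [10, 20]` non-coloops
  (`10 ≤ m`: `card_nonColoops_ge_ten`), whence `s₄(M ＼ e) ≤ ⌊28·m/(m − 4)⌋ ≤ 46` (`m = 10`), `≤ 35` at `m = 20`;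
* every point has `≤ 2` series partners: the averaged `x` has `m ≥ 21`, `s₄(M ＼ x) ≤ ⌊21·28/17⌋ = 34`, and
  `s₄ − ⌊s₄/6⌋ ≤ 34` gives `s₄ ≤ 40`.
**`ncard_fourCircuits_le_fortySix_of_seven_free`** — `s₄ ≤ 46`; the plain chain gives `⌊24·46/20⌋ = 55`, and the
cell `(17, 7)` (coloop-free, `s₅ ≤ 295` by S2CapFree) closes iff `s₄ ≤ 47`. Axioms: standard.
-/

open scoped Matroid

namespace PercRepro

namespace S2

open Set

variable {α : Type}

/-- **A coloop of `M ＼ e` that is not a coloop of `M` lies in every circuit of `M` through `e`**: otherwise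
`e ∈ cl(C ∖ e) ⊆ cl(E ∖ {e, f})`, so `cl(E ∖ {f}) = cl(insert e (E ∖ {e, f})) = cl(E ∖ {e, f}) ∌ f` — against
`f ∈ cl(E ∖ {f})` (`f` is not a coloop of `M`). -/
theorem mem_of_isColoop_delete_of_mem_isCircuit (M : Matroid α) {e f : α} (hfc : ¬ M.IsColoop f)
    (hf : (M ＼ {e}).IsColoop f) {C : Set α} (hC : M.IsCircuit C) (heC : e ∈ C) : f ∈ C := by
  rw [Matroid.delete_isColoop_iff] at hf
  obtain ⟨hfcl, hfE, hfe⟩ := hf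
  have hfe' : f ≠ e := by simpa using hfe
  by_contra hfC
  set S := (M.E \ {e}) \ {f} with hS
  have heS : e ∈ M.closure S := by
    have h1 : e ∈ M.closure (C \ {e}) := hC.mem_closure_sdiff_singleton_of_mem heC
    refine M.closure_subset_closure ?_ h1
    intro x hx
    refine ⟨⟨hC.subset_ground hx.1, hx.2⟩, ?_⟩
    intro hxf
    rw [Set.mem_singleton_iff] at hxf
    exact hfC (hxf ▸ hx.1)
  have hE : M.E \ {f} = insert e S := by
    ext x
    simp only [hS, Set.mem_sdiff, Set.mem_singleton_iff, Set.mem_insert_iff]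
    constructor
    · rintro ⟨hxE, hxf⟩
      by_cases hxe : x = e
      · exact Or.inl hxe
      · exact Or.inr ⟨⟨hxE, hxe⟩, hxf⟩
    · rintro (rfl | ⟨⟨hxE, -⟩, hxf⟩)
      · exact ⟨hC.subset_ground heC, hfe'.symm⟩
      · exact ⟨hxE, hxf⟩
  have hfcl' : f ∈ M.closure (M.E \ {f}) := by
    by_contra h
    exact hfc ((Matroid.isColoop_iff_notMem_closure_compl hfE).2 h)
  rw [hE, Matroid.closure_insert_eq_of_mem_closure heS] at hfcl'
  exact hfcl hfcl'

/-- On a coloop-free `M`, every quad through `e` contains `{e} ∪ coloops(M ＼ e)`. -/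
theorem insert_coloops_delete_subset_of_fourCircuitThrough (M : Matroid α) (hcol : M.coloops = ∅) (e : α)
    {C : Set α} (hC : C ∈ {C : Set α | M.IsCircuit C ∧ C.ncard = 4 ∧ e ∈ C}) :
    insert e (M ＼ {e}).coloops ⊆ C := by
  obtain ⟨hC, -, heC⟩ := hC
  intro x hx
  rcases hx with rfl | hx
  · exact heC
  · have hxc : ¬ M.IsColoop x := by
      rw [Matroid.isColoop_iff_mem_coloops, hcol]
      exact Set.notMem_empty x
    exact mem_of_isColoop_delete_of_mem_isCircuit M hxc hx hC heC

/-- `e ∉ coloops(M ＼ e)`. -/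
theorem notMem_coloops_delete (M : Matroid α) (e : α) : e ∉ (M ＼ {e}).coloops := by
  intro h
  have := (M ＼ {e}).coloops_subset_ground h
  rw [Matroid.delete_ground] at this
  exact this.2 (Set.mem_singleton e)

/-- **No quad through `e` when `M ＼ e` has `≥ 4` coloops** (and `M` none): a quad through `e` would contain the
`≥ 5` points `{e} ∪ coloops(M ＼ e)`. -/
theorem ncard_fourCircuitsThrough_eq_zero_of_four_le (M : Matroid α) [M.Finite] (hcol : M.coloops = ∅) (e : α)
    (hk : 4 ≤ (M ＼ {e}).coloops.ncard) : {C : Set α | M.IsCircuit C ∧ C.ncard = 4 ∧ e ∈ C}.ncard = 0 := by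
  have hempty : {C : Set α | M.IsCircuit C ∧ C.ncard = 4 ∧ e ∈ C} = ∅ := by
    apply Set.eq_empty_of_forall_notMem
    intro C hC
    have hsub := insert_coloops_delete_subset_of_fourCircuitThrough M hcol e hC
    have hCfin : C.Finite := M.ground_finite.subset hC.1.subset_ground
    have h1 := Set.ncard_le_ncard hsub hCfin
    have hKfin : (M ＼ {e}).coloops.Finite :=
      (M ＼ {e}).ground_finite.subset (M ＼ {e}).coloops_subset_ground
    rw [Set.ncard_insert_of_notMem (notMem_coloops_delete M e) hKfin] at h1
    have := hC.2.1
    omega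
  rw [hempty, Set.ncard_empty]

/-- **At most one quad through `e` when `M ＼ e` has exactly `3` coloops** (and `M` none): it is `{e} ∪ coloops(M ＼ e)`. -/
theorem ncard_fourCircuitsThrough_le_one_of_three (M : Matroid α) [M.Finite] (hcol : M.coloops = ∅) (e : α)
    (hk : (M ＼ {e}).coloops.ncard = 3) : {C : Set α | M.IsCircuit C ∧ C.ncard = 4 ∧ e ∈ C}.ncard ≤ 1 := by
  have hfin : {C : Set α | M.IsCircuit C ∧ C.ncard = 4 ∧ e ∈ C}.Finite :=
    M.ground_finite.finite_subsets.subset (fun C hC => hC.1.subset_ground)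
  rw [Set.ncard_le_one_iff hfin]
  intro C C' hC hC'
  have hKfin : (M ＼ {e}).coloops.Finite :=
    (M ＼ {e}).ground_finite.subset (M ＼ {e}).coloops_subset_ground
  have hcard : (insert e (M ＼ {e}).coloops).ncard = 4 := by
    rw [Set.ncard_insert_of_notMem (notMem_coloops_delete M e) hKfin, hk]
  have h1 : insert e (M ＼ {e}).coloops = C :=
    Set.eq_of_subset_of_ncard_le (insert_coloops_delete_subset_of_fourCircuitThrough M hcol e hC)
      (by rw [hcard, hC.2.1]) (M.ground_finite.subset hC.1.subset_ground)
  have h2 : insert e (M ＼ {e}).coloops = C' :=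
    Set.eq_of_subset_of_ncard_le (insert_coloops_delete_subset_of_fourCircuitThrough M hcol e hC')
      (by rw [hcard, hC'.2.1]) (M.ground_finite.subset hC'.1.subset_ground)
  rw [← h1, ← h2]

/-- **The nullity drops by one under the deletion of a non-coloop** (p2's bookkeeping, S1CoreCapThirtyTwo). -/
theorem delete_nullity_of_nonColoop' (M : Matroid α) [M.Finite] {d : ℕ} (hd : M.E.encard = M.eRank + (d + 1))
    {y : α} (hy : y ∈ M.E) (hyc : ¬ M.IsColoop y) : (M ＼ {y}).E.encard = (M ＼ {y}).eRank + d := by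
  have hν : M✶.eRank = ((d + 1 : ℕ) : ℕ∞) := by
    have h := _root_.Matroid.eRank_add_eRank_dual M
    rw [hd] at h
    exact WithTop.add_left_cancel (PercRepro.Matroid.eRank_ne_top_of_finite M) h
  have hdel := PercRepro.Matroid.dual_eRank_delete_singleton_add_one hy hyc
  rw [hν] at hdel
  have hfin' : (M ＼ {y})✶.eRank ≠ ⊤ := by
    intro h
    rw [h] at hdel
    have h2 : ((d + 1 : ℕ) : ℕ∞) = ⊤ := by rw [← hdel]; simp
    exact ENat.coe_ne_top _ h2
  obtain ⟨d', hd'⟩ := ENat.ne_top_iff_exists.1 hfin'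
  have hdd' : d = d' := by
    rw [← hd'] at hdel
    have : d' + 1 = d + 1 := by exact_mod_cast hdel
    omega
  subst hdd'
  have h := _root_.Matroid.eRank_add_eRank_dual (M ＼ {y})
  rw [← hd'] at h
  exact h.symm

/-- **THE SERIES-CLASS AVERAGING AT `(24, 7)`: `s₄ ≤ 46` on every coloop-free core of nullity `7` on `24` points**,
given `s₄ ≤ 28` on every core of nullity `5`. -/
theorem ncard_fourCircuits_le_fortySix_of_seven_free (M : Matroid α) [M.Finite]
    (hfree : ∀ e ∈ M.E, ∃ A ⊆ M.E \ {e}, e ∉ M.closure A ∧ e ∉ M.closure ((M.E \ {e}) \ A))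
    (hd : M.E.encard = M.eRank + 7) (hn : M.E.ncard = 24) (hcol : M.coloops = ∅)
    (hB5 : ∀ (M' : Matroid α) [M'.Finite],
      (∀ e ∈ M'.E, ∃ A ⊆ M'.E \ {e}, e ∉ M'.closure A ∧ e ∉ M'.closure ((M'.E \ {e}) \ A)) →
      M'.E.encard = M'.eRank + 5 → {C : Set α | M'.IsCircuit C ∧ C.ncard = 4}.ncard ≤ 28) :
    {C : Set α | M.IsCircuit C ∧ C.ncard = 4}.ncard ≤ 46 := by
  classical
  -- the deletion of any point `e`: a core of nullity `6` on `23` points with `k` coloops, `23 − k ≥ 10` non-coloops,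
  -- and the averaging step `s₄(M ＼ e) − ⌊4·s₄(M ＼ e)/(23 − k)⌋ ≤ 28`
  have hdel : ∀ e ∈ M.E, ∀ k, (M ＼ {e}).coloops.ncard = k →
      {C : Set α | (M ＼ {e}).IsCircuit C ∧ C.ncard = 4}.ncard -
        4 * {C : Set α | (M ＼ {e}).IsCircuit C ∧ C.ncard = 4}.ncard / (23 - k) ≤ 28 ∧ 10 ≤ 23 - k := by
    intro e heE k hk
    have hec : ¬ M.IsColoop e := by
      rw [Matroid.isColoop_iff_mem_coloops, hcol]
      exact Set.notMem_empty e
    have hd' : M.E.encard = M.eRank + ((6 : ℕ) + 1) := by rw [hd]; norm_num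
    have hfreeN := S1.hfree_delete M hfree e
    have hd6 : (M ＼ {e}).E.encard = (M ＼ {e}).eRank + 6 := delete_nullity_of_nonColoop' M hd' heE hec
    have hNE : (M ＼ {e}).E.ncard = 23 := by
      rw [Matroid.delete_ground, Set.ncard_sdiff_singleton_of_mem heE, hn]
    have hKsub : (M ＼ {e}).coloops ⊆ (M ＼ {e}).E := (M ＼ {e}).coloops_subset_ground
    have hnc : ((M ＼ {e}).E \ (M ＼ {e}).coloops).ncard = 23 - k := by
      rw [Set.ncard_sdiff hKsub ((M ＼ {e}).ground_finite.subset hKsub), hNE, hk]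
    have h10 := S1.card_nonColoops_ge_ten (M ＼ {e}) hfreeN hd6
    rw [hnc] at h10
    refine ⟨?_, h10⟩
    have hd5 : (M ＼ {e}).E.encard = (M ＼ {e}).eRank + ((5 : ℕ) + 1) := by rw [hd6]; norm_num
    exact S1.ncard_fourCircuits_sub_div_le_of_nonColoops (M ＼ {e}) hfreeN hd5 (m := 23 - k) (by omega)
      (by rw [hnc]) hB5
  by_cases hA : ∃ e ∈ M.E, 3 ≤ (M ＼ {e}).coloops.ncard
  · -- CASE A: a point with `≥ 3` series partners
    obtain ⟨e, heE, hk3⟩ := hA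
    obtain ⟨k, hk⟩ : ∃ k, (M ＼ {e}).coloops.ncard = k := ⟨_, rfl⟩
    rw [hk] at hk3
    obtain ⟨havg, h10⟩ := hdel e heE k hk
    have hN := S1.le_mul_div_of_sub_div_le (m := 23 - k) (by omega) havg
    have hsplit := S1.ncard_fourCircuits_le_through_add_delete M e
    rcases Nat.lt_or_ge k 4 with hk4 | hk4
    · -- `k = 3`: at most one quad through `e`, and `m = 20`
      have hk3' : k = 3 := by omega
      have hthr := ncard_fourCircuitsThrough_le_one_of_three M hcol e (by rw [hk, hk3'])
      rw [hk3'] at hN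
      omega
    · -- `k ≥ 4`: no quad through `e`, and `10 ≤ m ≤ 19`
      have hthr := ncard_fourCircuitsThrough_eq_zero_of_four_le M hcol e (by rw [hk]; exact hk4)
      have hN46 : {C : Set α | (M ＼ {e}).IsCircuit C ∧ C.ncard = 4}.ncard ≤ 46 := by
        refine hN.trans ?_
        have hk13 : k ≤ 13 := by omega
        interval_cases k <;> norm_num
      omega
  · -- CASE B: every point has `≤ 2` series partners
    push Not at hA
    rcases Nat.eq_zero_or_pos {C : Set α | M.IsCircuit C ∧ C.ncard = 4}.ncard with h0 | hpos
    · omega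
    obtain ⟨x, hxE, -, hx⟩ := S1.exists_nonColoop_ncard_fourCircuitsThrough_le M hpos
    have hm24 : (M.ground_finite.toFinset.filter (fun x => ¬ M.IsColoop x)).card = 24 := by
      rw [Finset.filter_true_of_mem, ← Set.ncard_eq_toFinset_card _ M.ground_finite, hn]
      intro y _
      rw [Matroid.isColoop_iff_mem_coloops, hcol]
      exact Set.notMem_empty y
    rw [hm24] at hx
    obtain ⟨k, hk⟩ : ∃ k, (M ＼ {x}).coloops.ncard = k := ⟨_, rfl⟩
    have hk2 : k ≤ 2 := by have := hA x hxE; omega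
    obtain ⟨havg, -⟩ := hdel x hxE k hk
    have hN := S1.le_mul_div_of_sub_div_le (m := 23 - k) (by omega) havg
    have hN34 : {C : Set α | (M ＼ {x}).IsCircuit C ∧ C.ncard = 4}.ncard ≤ 34 := by
      refine hN.trans ?_
      interval_cases k <;> norm_num
    have hsplit := S1.ncard_fourCircuits_le_through_add_delete M x
    omega

end S2

end PercRepro
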